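import Mathlib
import HarnessLib

/-!
# Coercivity after a finite-rank shift from a certified spectral cut (the "lift the low modes" step)

Topic `Literature/Analysis/OperatorTheory`; proofs-layer file (theorems only, no definitions, no named facts).

In an enclosure of an eigenvalue of a NON-normal operator `A` by a resolvent bound on a contour, the one-point
certificate of `PseudospectralEnclosureNet.exists_hasBoundedInverse_norm_le_of_coercive` wants COERCIVITY of a
shifted operator `G_z = A − z + s P_V` where `P_V` is the orthogonal projection onto an explicit span of Ritz
vectors (the finite-rank "Gershgorin lift" of the low modes of the symmetric part; Plum's spectral shift by
finite rank). The real part of the form of `G_z` is `a(u) − Re z ‖u‖² + s ‖P_V u‖²` with `a(u) = Re ⟪A u, u⟫`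
the form of the symmetric part. This file isolates the two elementary inequalities that turn the CERTIFIED data

* a global lower bound `a(u) ≥ a_min ‖u‖²` (e.g. `a_min = ¼ − g⁻` from a sup-norm certificate),
* a spectral cut: `a(u) ≥ β ‖u‖²` on the orthogonal complement of the (unknown) true low spectral subspace `W`,
  which reduces the form (equivalently `a(u) ≥ β ‖u‖² − (β − a_min) ‖P_W u‖²` for all `u`),
* a certified subspace-perturbation bound `‖P_W u − P_V u‖ ≤ θ ‖u‖` (Davis–Kahan `sin Θ` from Ritz residuals and
  a gap [cite: DavisKahan1970, Thm. sin Θ]),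

into coercivity of the shifted form with the EXPLICIT constant `β − 2 (β − a_min) θ²` for any shift
`s ≥ 2 (β − a_min)`:

* `le_form_of_reducing_cut` — from the reducing decomposition `a(u) = a(P_W u) + a(u − P_W u)`, Pythagoras, the
  global bound and the cut on `ker P_W`: `β ‖u‖² − (β − a_min) ‖P_W u‖² ≤ a(u)` [cite: WeinsteinStenger1972, Ch. 2 (min–max / Glazman lemma bookkeeping)];
* `coercive_of_cut_of_proj_near` — from that inequality and `‖P_W u − P_V u‖ ≤ θ ‖u‖`:
  `(β − 2 (β − a_min) θ²) ‖u‖² ≤ a(u) + s ‖P_V u‖²` whenever `2 (β − a_min) ≤ s` [folklore].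

The form `a` enters only through its values `a u : ℝ` on a domain `p`; nothing is assumed about how it arises, so
the lemmas apply verbatim to `u ↦ Re ⟪A u, u⟫` of an unbounded operator. Everything is proved; nothing about any
particular operator is asserted.

## References

* C. Davis, W. M. Kahan, *The rotation of eigenvectors by a perturbation. III*, SIAM J. Numer. Anal. 7 (1970) 1–46. [DavisKahan1970]
* A. Weinstein, W. Stenger, *Methods of Intermediate Problems for Eigenvalues*, Academic Press 1972, Ch. 2. [WeinsteinStenger1972]
* M. Plum, *Guaranteed numerical bounds for eigenvalues*, in: Spectral Theory and Computational Methods of Sturm–Liouville Problems, Dekker 1997 (the finite-rank spectral shift).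
-/

noncomputable section

open scoped InnerProductSpace

namespace Literature.Analysis.OperatorTheory

variable {𝕜 : Type*} [RCLike 𝕜] {E : Type*} [NormedAddCommGroup E] [InnerProductSpace 𝕜 E]

/-- **Spectral cut in reducing form** [folklore]. If the form `a` splits along the projection `PW`
(`a u = a (PW u) + a (u - PW u)` on the domain `p`, which `PW` preserves), the norm splits by Pythagoras, `a` is
bounded below by `amin` on `p` and by `β` on `p ∩ ker PW`, then `β ‖u‖² − (β − amin) ‖PW u‖² ≤ a u` on `p`. -/
theorem le_form_of_reducing_cut (p : Submodule 𝕜 E) (a : E → ℝ) (PW : E →L[𝕜] E) (amin β : ℝ)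
    (hmem : ∀ u ∈ p, PW u ∈ p)
    (hsplit : ∀ u ∈ p, a u = a (PW u) + a (u - PW u))
    (hpyth : ∀ u : E, ‖u‖ ^ 2 = ‖PW u‖ ^ 2 + ‖u - PW u‖ ^ 2)
    (hidem : ∀ u : E, PW (u - PW u) = 0)
    (hmin : ∀ u ∈ p, amin * ‖u‖ ^ 2 ≤ a u)
    (hcut : ∀ u ∈ p, PW u = 0 → β * ‖u‖ ^ 2 ≤ a u) :
    ∀ u ∈ p, β * ‖u‖ ^ 2 - (β - amin) * ‖PW u‖ ^ 2 ≤ a u := by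
  intro u hu
  have h1 : amin * ‖PW u‖ ^ 2 ≤ a (PW u) := hmin _ (hmem u hu)
  have hmem' : u - PW u ∈ p := p.sub_mem hu (hmem u hu)
  have h2 : β * ‖u - PW u‖ ^ 2 ≤ a (u - PW u) := hcut _ hmem' (hidem u)
  rw [hsplit u hu]
  have h3 : β * ‖u‖ ^ 2 = β * ‖PW u‖ ^ 2 + β * ‖u - PW u‖ ^ 2 := by rw [hpyth u]; ring
  linarith [h1, h2, h3]

/-- **Coercivity of the finite-rank-shifted form** [folklore]. From the cut inequality
`β ‖u‖² − (β − amin) ‖PW u‖² ≤ a u` (e.g. `le_form_of_reducing_cut`), `amin ≤ β`, a certified proximity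
`‖PW u − PV u‖ ≤ θ ‖u‖` of an EXPLICIT projection `PV` to the true one, and a shift `s ≥ 2 (β − amin)`:
`(β − 2 (β − amin) θ²) ‖u‖² ≤ a u + s ‖PV u‖²` on `p`. With `Re z < β − 2 (β − amin) θ²` this is the coercivity
`Re ⟪(A − z + s PV) u, u⟫ ≥ δ ‖u‖²` the one-point resolvent certificate consumes. -/
theorem coercive_of_cut_of_proj_near (p : Submodule 𝕜 E) (a : E → ℝ) (PW PV : E →L[𝕜] E)
    (amin β θ s : ℝ) (hβ : amin ≤ β) (hθ : 0 ≤ θ) (hs : 2 * (β - amin) ≤ s)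
    (hcut : ∀ u ∈ p, β * ‖u‖ ^ 2 - (β - amin) * ‖PW u‖ ^ 2 ≤ a u)
    (hnear : ∀ u : E, ‖PW u - PV u‖ ≤ θ * ‖u‖) :
    ∀ u ∈ p, (β - 2 * (β - amin) * θ ^ 2) * ‖u‖ ^ 2 ≤ a u + s * ‖PV u‖ ^ 2 := by
  intro u hu
  have hc := hcut u hu
  -- ‖PW u‖ ≤ ‖PV u‖ + θ ‖u‖
  have htri : ‖PW u‖ ≤ ‖PV u‖ + θ * ‖u‖ := by
    have := norm_le_insert' (PW u) (PV u)
    -- norm_le_insert' : ‖a‖ ≤ ‖b‖ + ‖a - b‖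
    linarith [hnear u]
  have hPV : 0 ≤ ‖PV u‖ := norm_nonneg _
  have hu0 : 0 ≤ ‖u‖ := norm_nonneg _
  have hPW : 0 ≤ ‖PW u‖ := norm_nonneg _
  -- (x + y)² ≤ 2x² + 2y²
  have hsq : ‖PW u‖ ^ 2 ≤ 2 * ‖PV u‖ ^ 2 + 2 * (θ * ‖u‖) ^ 2 := by
    have h0 : 0 ≤ ‖PV u‖ + θ * ‖u‖ := by positivity
    have h1 : ‖PW u‖ ^ 2 ≤ (‖PV u‖ + θ * ‖u‖) ^ 2 := by
      exact pow_le_pow_left₀ hPW htri 2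
    nlinarith [h1, sq_nonneg (‖PV u‖ - θ * ‖u‖)]
  have hβa : 0 ≤ β - amin := by linarith
  have h4 : (β - amin) * ‖PW u‖ ^ 2 ≤ (β - amin) * (2 * ‖PV u‖ ^ 2 + 2 * (θ * ‖u‖) ^ 2) :=
    mul_le_mul_of_nonneg_left hsq hβa
  have h5 : s * ‖PV u‖ ^ 2 ≥ 2 * (β - amin) * ‖PV u‖ ^ 2 :=
    by nlinarith [hs, sq_nonneg ‖PV u‖]
  nlinarith [hc, h4, h5, sq_nonneg (θ * ‖u‖)]

/-- The two steps combined, with the shift taken exactly `s = 2 (β − amin)` [folklore]. -/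
theorem coercive_of_reducing_cut_of_proj_near (p : Submodule 𝕜 E) (a : E → ℝ) (PW PV : E →L[𝕜] E)
    (amin β θ : ℝ) (hβ : amin ≤ β) (hθ : 0 ≤ θ)
    (hmem : ∀ u ∈ p, PW u ∈ p)
    (hsplit : ∀ u ∈ p, a u = a (PW u) + a (u - PW u))
    (hpyth : ∀ u : E, ‖u‖ ^ 2 = ‖PW u‖ ^ 2 + ‖u - PW u‖ ^ 2)
    (hidem : ∀ u : E, PW (u - PW u) = 0)
    (hmin : ∀ u ∈ p, amin * ‖u‖ ^ 2 ≤ a u)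
    (hcut : ∀ u ∈ p, PW u = 0 → β * ‖u‖ ^ 2 ≤ a u)
    (hnear : ∀ u : E, ‖PW u - PV u‖ ≤ θ * ‖u‖) :
    ∀ u ∈ p, (β - 2 * (β - amin) * θ ^ 2) * ‖u‖ ^ 2 ≤ a u + 2 * (β - amin) * ‖PV u‖ ^ 2 :=
  coercive_of_cut_of_proj_near p a PW PV amin β θ (2 * (β - amin)) hβ hθ le_rfl
    (le_form_of_reducing_cut p a PW amin β hmem hsplit hpyth hidem hmin hcut) hnear

end Literature.Analysis.OperatorTheory

end
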